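import Mathlib
import Summits.AtomisticToContinuum.HydrodynamicLimit.Theorems.ImplosionDichotomyDenseExcursionPackingAnalyticMajorantAnalytic

/-!
# The SEEDED majorant lemma for an analytic nonlinearity: geometric growth of the hierarchy of `Γ` when the
# resolvent gain starts only at order `k₀`
# (crux `DenseExcursion`, stmt-AtomisticToContinuum-12586, line `sonic-cavity-renewal` v7, stub `stub_analyticPackingImplosion`)

Helper file (`--supports stmt-AtomisticToContinuum-12586`, line lead a2, wave-3 worker D). Sequel of
`…PackingAnalyticMajorantAnalytic.lean` (`analytic_majorant`, the case `k₀ = 2`). In the construction of the analytic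
packing implosion `Γ = SS + Σ_k Gᵏ X_k` the quantitative linear input `PackingResolvent r W S`
(`…PackingAnalyticDefsB`) gives the Laplace gain `‖X_k‖ ≤ C‖Src_k‖/k` only from some order `k₀` on (numerically
`k₀ = 5`: the sonic Frobenius exponent `ν(kμ)` is negative only for `kμ > b(0)`); below `k₀` it gives mere existence
with finite norm. So the norms `t k = ‖X_k‖` obey the majorant recursion
`t k ≤ Σ_{m=2}^{k} a_m [Gᵏ] T(G)^m`, `T = Σ t i Gⁱ`, `0 ≤ a_m ≤ A αᵐ`, ONLY FOR `k ≥ k₀`, the finitely many SEEDS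
`t 1, …, t (k₀ − 1)` being arbitrary nonnegative numbers. Kernel-checked here:

* `analytic_majorant_seeded` (REGISTERED helper): with `L = 16α + 16Aα² + 1`, if the seeds satisfy
  `t k · L ≤ Bᵏ/k²` (`1 ≤ k < k₀`) for some `B ≥ 0`, then EVERY `t k`, `k ≥ 1`, satisfies `t k · L ≤ Bᵏ/k²` — the
  same `1/k²`-weight induction as `analytic_majorant` (`coeff_pow_mono_top`, `coeff_pow_weight_le`), whose step
  uses only `K = 1/L` and is insensitive to `B`;
* `exists_seedBound`: such a `B` always exists (`B = 1 + Σ_{k<k₀} t k · L · k²`);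
* `summable_of_analytic_majorant_seeded`: then `Σ t k gᵏ` converges for `|g| · B < 1` (radius `≥ 1/B > 0`).

Pure real analysis / combinatorics over Mathlib's `PowerSeries`. NOT here: the norms, the resolvent, or `Γ` itself.
-/

noncomputable section

open Finset PowerSeries

namespace Summit.AtomisticToContinuum.HydrodynamicLimit.Theorems.PackingAnalyticImplosion

/-- **THE SEEDED MAJORANT LEMMA** (registered helper `analytic_majorant_seeded` of `stub_analyticPackingImplosion`):
a nonnegative sequence `t` with `t 0 = 0` obeying the majorant recursion `t k ≤ Σ_{m=2}^{k} a_m · [Gᵏ] T(G)^m`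
(`[Gᵏ] T^m = PowerSeries.coeff k (PowerSeries.mk t ^ m)`, `0 ≤ a_m ≤ A αᵐ`) only for `k ≥ k₀`, whose seeds satisfy
`t k · (16α + 16Aα² + 1) ≤ Bᵏ/k²` for `1 ≤ k < k₀`, satisfies `t k · (16α + 16Aα² + 1) ≤ Bᵏ/k²` for EVERY `k ≥ 1`.
(`analytic_majorant` is the case `k₀ = 2`, `B = t 1 · (16α + 16Aα² + 1)`.) [folklore] -/
theorem analytic_majorant_seeded : ∀ (t a : ℕ → ℝ) (A α B : ℝ) (k₀ : ℕ), 0 ≤ A → 0 ≤ α → 0 ≤ B → t 0 = 0 → (∀ k, 0 ≤ t k) → (∀ m, 0 ≤ a m) → (∀ m, a m ≤ A * α ^ m) → (∀ k, 1 ≤ k → k < k₀ → t k * (16 * α + 16 * A * α ^ 2 + 1) ≤ B ^ k / (k : ℝ) ^ 2) → (∀ k, k₀ ≤ k → t k ≤ ∑ m ∈ Finset.Ico 2 (k + 1), a m * PowerSeries.coeff k (PowerSeries.mk t ^ m)) → ∀ k, 1 ≤ k → t k * (16 * α + 16 * A * α ^ 2 + 1) ≤ B ^ k / (k : ℝ)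 ^ 2 := by
  intro t a A α B k₀ hA hα hB ht0 ht ha haA hseed hrec
  -- constants
  set L : ℝ := 16 * α + 16 * A * α ^ 2 + 1 with hL
  have hL1 : 1 ≤ L := by rw [hL]; nlinarith [mul_nonneg hA (sq_nonneg α)]
  have hL0 : 0 < L := by linarith
  set K : ℝ := 1 / L with hK
  have hK0 : 0 < K := by rw [hK]; positivity
  have hKL : K * L = 1 := by rw [hK]; field_simp
  have hx : 8 * α * K ≤ 1 / 2 := by
    rw [hK, le_div_iff₀ (by norm_num : (0:ℝ) < 2)]
    rw [show 8 * α * (1 / L) * 2 = 16 * α / L by ring, div_le_one hL0, hL]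
    nlinarith [mul_nonneg hA (sq_nonneg α)]
  have hx0 : 0 ≤ 8 * α * K := by positivity
  have hAK : 16 * A * α ^ 2 * K ≤ 1 := by
    rw [hK, show 16 * A * α ^ 2 * (1 / L) = 16 * A * α ^ 2 / L by ring, div_le_one hL0, hL]
    nlinarith
  -- the two forms of the bound
  have toK : ∀ k, t k * L ≤ B ^ k / (k : ℝ) ^ 2 → t k ≤ K * B ^ k / (k : ℝ) ^ 2 := by
    intro k h
    have h' := mul_le_mul_of_nonneg_right h hK0.le
    calc t k = t k * L * K := by rw [mul_assoc, mul_comm L K, hKL, mul_one]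
      _ ≤ B ^ k / (k : ℝ) ^ 2 * K := h'
      _ = K * B ^ k / (k : ℝ) ^ 2 := by ring
  have ofK : ∀ k, t k ≤ K * B ^ k / (k : ℝ) ^ 2 → t k * L ≤ B ^ k / (k : ℝ) ^ 2 := by
    intro k h
    have h' := mul_le_mul_of_nonneg_right h hL0.le
    calc t k * L ≤ K * B ^ k / (k : ℝ) ^ 2 * L := h'
      _ = (K * L) * (B ^ k / (k : ℝ) ^ 2) := by ring
      _ = B ^ k / (k : ℝ) ^ 2 := by rw [hKL, one_mul]
  -- the claim in `K, B` form
  suffices H : ∀ k, 1 ≤ k → t k ≤ K * B ^ k / (k : ℝ) ^ 2 from fun k hk => ofK k (H k hk)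
  intro k
  induction k using Nat.strong_induction_on with
  | _ k ih =>
  intro hk
  rcases Nat.lt_or_ge k k₀ with hlt | hge
  · -- a seed
    exact toK k (hseed k hk hlt)
  rcases Nat.lt_or_ge k 2 with hk1 | hk2
  · -- `k = 1 ≥ k₀`: the recursion has an empty right-hand side
    obtain rfl : k = 1 := by omega
    have h := hrec 1 hge
    rw [Finset.Ico_self, Finset.sum_empty] at h
    have : 0 ≤ K * B ^ 1 / ((1 : ℕ) : ℝ) ^ 2 := by positivity
    linarith
  · -- the weights `c i = K B^i / i²` dominate `t` strictly below `k`
    have hk' : (0 : ℝ) < k := by exact_mod_cast (show 0 < k by omega)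
    set c : ℕ → ℝ := fun i => K * B ^ i / (i : ℝ) ^ 2 with hc
    have hcnn : ∀ i, 0 ≤ c i := fun i => by rw [hc]; positivity
    have hc0 : c 0 = 0 := by simp [hc]
    have hct : ∀ i, i < k → 0 ≤ t i ∧ t i ≤ c i := by
      intro i hi
      refine ⟨ht i, ?_⟩
      rcases Nat.eq_zero_or_pos i with rfl | hi0
      · rw [ht0, hc0]
      · exact ih i hi hi0
    calc t k ≤ ∑ m ∈ Ico 2 (k + 1), a m * coeff k ((PowerSeries.mk t) ^ m) := hrec k hge
      _ ≤ ∑ m ∈ Ico 2 (k + 1), a m * coeff k ((PowerSeries.mk c) ^ m) := by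
          refine sum_le_sum fun m hm => mul_le_mul_of_nonneg_left ?_ (ha m)
          obtain ⟨n, rfl⟩ : ∃ n, m = n + 2 := ⟨m - 2, by rw [mem_Ico] at hm; omega⟩
          exact coeff_pow_mono_top ht0 hc0 (ht k) (hcnn k) hct n
      _ ≤ ∑ m ∈ Ico 2 (k + 1), (A * α ^ m) * (K ^ m * B ^ k * 8 ^ (m - 1) / (k : ℝ) ^ 2) := by
          refine sum_le_sum fun m hm => ?_
          obtain ⟨n, rfl⟩ : ∃ n, m = n + 2 := ⟨m - 2, by rw [mem_Ico] at hm; omega⟩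
          have hw := coeff_pow_weight_le hK0.le hB (n + 1) k hk
          have hnn : 0 ≤ coeff k ((PowerSeries.mk c) ^ (n + 2)) :=
            (coeff_pow_mono (t := c) (c := c) (j := k) (fun i _ => ⟨hcnn i, le_rfl⟩) (n + 2) k le_rfl).1
          rw [show n + 2 - 1 = n + 1 by omega]
          exact mul_le_mul (haA _) hw hnn (by positivity)
      _ = (B ^ k / (k : ℝ) ^ 2) * (A * α * K) * ((8 * α * K) * ∑ j ∈ range (k + 1 - 2), (8 * α * K) ^ j) := by
          rw [sum_Ico_eq_sum_range, mul_sum, mul_sum]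
          refine sum_congr rfl fun j _ => ?_
          rw [show 2 + j - 1 = j + 1 by omega]
          ring
      _ ≤ (B ^ k / (k : ℝ) ^ 2) * (A * α * K) * ((8 * α * K) * 2) := by
          have hgeom : ∑ j ∈ range (k + 1 - 2), (8 * α * K) ^ j ≤ 2 := by
            have hg := geom_sum_mul_neg (8 * α * K) (k + 1 - 2)
            have hpow : 0 ≤ (8 * α * K) ^ (k + 1 - 2) := pow_nonneg hx0 _
            nlinarith [sum_nonneg (fun j (_ : j ∈ range (k + 1 - 2)) => pow_nonneg hx0 j)]
          gcongr
      _ = (K * B ^ k / (k : ℝ) ^ 2) * (16 * A * α ^ 2 * K) := by ring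
      _ ≤ K * B ^ k / (k : ℝ) ^ 2 := mul_le_of_le_one_right (by positivity) hAK

/-- A bound `B ≥ 0` dominating finitely many seeds always exists: `B = 1 + Σ_{k<k₀} t k · L · k²` gives
`t k · L ≤ B ≤ Bᵏ ≤ Bᵏ · (k²/k²)`, i.e. `t k · L ≤ Bᵏ/k²`, for `1 ≤ k < k₀`. [folklore] -/
theorem exists_seedBound (t : ℕ → ℝ) (L : ℝ) (k₀ : ℕ) (ht : ∀ k, 0 ≤ t k) (hL : 0 ≤ L) :
    ∃ B : ℝ, 0 ≤ B ∧ ∀ k, 1 ≤ k → k < k₀ → t k * L ≤ B ^ k / (k : ℝ) ^ 2 := by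
  have hnn : ∀ j, 0 ≤ t j * L * (j : ℝ) ^ 2 := fun j => mul_nonneg (mul_nonneg (ht j) hL) (sq_nonneg _)
  refine ⟨1 + ∑ j ∈ range k₀, t j * L * (j : ℝ) ^ 2, ?_, ?_⟩
  · have : 0 ≤ ∑ j ∈ range k₀, t j * L * (j : ℝ) ^ 2 := sum_nonneg fun j _ => hnn j
    linarith
  · intro k hk hlt
    set B : ℝ := 1 + ∑ j ∈ range k₀, t j * L * (j : ℝ) ^ 2 with hBdef
    have hsum : t k * L * (k : ℝ) ^ 2 ≤ ∑ j ∈ range k₀, t j * L * (j : ℝ) ^ 2 :=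
      single_le_sum (f := fun j => t j * L * (j : ℝ) ^ 2) (fun j _ => hnn j) (mem_range.mpr hlt)
    have hB1 : 1 ≤ B := by
      have : 0 ≤ ∑ j ∈ range k₀, t j * L * (j : ℝ) ^ 2 := sum_nonneg fun j _ => hnn j
      linarith
    have hBk : B ≤ B ^ k := by
      calc B = B ^ 1 := (pow_one B).symm
        _ ≤ B ^ k := pow_le_pow_right₀ hB1 hk
    have hk' : (0 : ℝ) < (k : ℝ) ^ 2 := by
      have : (1 : ℝ) ≤ k := by exact_mod_cast hk
      positivity
    rw [le_div_iff₀ hk']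
    linarith

/-- **Convergence of the seeded packing series**: under the hypotheses of `analytic_majorant_seeded`,
`Σ t k gᵏ` converges whenever `|g| · B < 1` — the radius of convergence of `Σ t k Gᵏ` is at least `1/B > 0`.
[folklore] -/
theorem summable_of_analytic_majorant_seeded {t a : ℕ → ℝ} {A α B : ℝ} {k₀ : ℕ} (hA : 0 ≤ A) (hα : 0 ≤ α)
    (hB : 0 ≤ B) (ht0 : t 0 = 0) (ht : ∀ k, 0 ≤ t k) (ha : ∀ m, 0 ≤ a m) (haA : ∀ m, a m ≤ A * α ^ m)
    (hseed : ∀ k, 1 ≤ k → k < k₀ → t k * (16 * α + 16 * A * α ^ 2 + 1) ≤ B ^ k / (k : ℝ) ^ 2)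
    (hrec : ∀ k, k₀ ≤ k → t k ≤ ∑ m ∈ Finset.Ico 2 (k + 1), a m * PowerSeries.coeff k (PowerSeries.mk t ^ m))
    {g : ℝ} (hg : |g| * B < 1) :
    Summable (fun k => t k * g ^ k) := by
  set L : ℝ := 16 * α + 16 * A * α ^ 2 + 1 with hL
  have hL1 : 1 ≤ L := by rw [hL]; nlinarith [mul_nonneg hA (sq_nonneg α)]
  have hL0 : 0 < L := by linarith
  have hmaj := analytic_majorant_seeded t a A α B k₀ hA hα hB ht0 ht ha haA hseed hrec
  have hq0 : 0 ≤ |g| * B := by positivity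
  refine Summable.of_norm_bounded (g := fun k : ℕ => (|g| * B) ^ k) (summable_geometric_of_lt_one hq0 hg) fun k => ?_
  rw [Real.norm_eq_abs, abs_mul, abs_of_nonneg (ht _), abs_pow]
  rcases Nat.eq_zero_or_pos k with rfl | hk
  · simp [ht0]
  have hk1 : (1 : ℝ) ≤ ((k : ℕ) : ℝ) ^ 2 := by
    have : (1 : ℝ) ≤ (k : ℝ) := by exact_mod_cast hk
    nlinarith
  have hb : t k ≤ B ^ k := by
    have h := hmaj k hk
    have h1 : B ^ k / (k : ℝ) ^ 2 ≤ B ^ k := div_le_self (by positivity) hk1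
    have h2 : t k ≤ t k * L := le_mul_of_one_le_right (ht k) hL1
    linarith
  calc t k * |g| ^ k ≤ B ^ k * |g| ^ k := by gcongr
    _ = (|g| * B) ^ k := by ring

end Summit.AtomisticToContinuum.HydrodynamicLimit.Theorems.PackingAnalyticImplosion

end
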